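import Summits.CriticalPhenomena.PercolationContinuityZ3.Theorems.PercNearOneGluingNoHeavyLowerTailSahiCTCRtThreeCorners
import HarnessLib

/-!
# `NoHeavyLowerTail` (crux stmt-CriticalPhenomena-4575), P3 lane: THE PIVOTAL FORM OF KLEITMAN'S LEMMA —
# the Kleitman surplus of a cube is an explicit nonnegative combination of doubly-pivotal atoms

Support file (seat `prim-l12-p3`, gen 50; `--supports stmt-CriticalPhenomena-4575`).  Memo
`run/shared/lean/prim/prim-l12/FROM-prim-l12-p3-g50-KLEITMAN-BULK.md` §1.

For ANY two families `𝒳, 𝒵` and any finset `W` with `m = #W` (no up-set hypothesis), the Kleitman surplus of the cube `2^W`,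
`κ(∅, W) = #{Y ⊆ W : Y ∈ 𝒳 ∩ 𝒵} − #{S ⊆ W : S ∈ 𝒳, W ∖ S ∈ 𝒵}` (`kap 𝒳 𝒵 ∅ W` of `…SahiCTCKleitmanSurplus`), equals the weighted sum of the
DOUBLY-PIVOTAL ATOMS `([A+u ∈ 𝒳] − [A ∈ 𝒳])·([B+u ∈ 𝒵] − [B ∈ 𝒵])` over all `A, B ⊆ W`, `u ∈ W ∖ (A ∪ B)`, the atom with top corner
`(S, S') = (A+u, B+u)` carrying the weight `ω_m(#(S ∆ S')) = s!·(m−1−s)!/m!`, `s = #(S ∆ S')` (`kap_empty_eq_atomSum`, with `ω_m(s) = 1/(m·C(m−1,s))`; in the language of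
`…SahiCTCRtThreeSepDefs`: the `J`-table `(a,b,c) ↦ ω_m(b+c)`, the four other tables zero; `kap_empty_eq_atomSum_of` for any weight `w` with
`r·w(s) − s·w(s−1) = [s=0] − [r=0]`, `r + s = m`).  The proof is the type identity
`a·ω(s) − b·ω(s−1) − c·ω(s−1) + o·ω(s) = [s = 0] − [a = o = 0]` (`sepE_pivotal`, `kleitWeight_identity`) fed into `atomSum_eq_sum_sepE`.
No new definitions.  For up-sets every atom is
`≥ 0` (`atomSum_nonneg`), which re-proves `κ ≥ 0` (`kap_empty_nonneg'`); the point of the identity is that it is the BULK of the all-`k`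
certificates of the rows of `R_3 ∈ ℕ[s]` (memo §2–§4: the squarefree row is `Σ_{#U ≤ 2} κ(∅, V∖U)` plus small terms, `coeff_ind_Rt_three_eq`).
Nothing is asserted about the crux.
-/

noncomputable section

open scoped Classical

namespace Summit.CriticalPhenomena.PercolationContinuityZ3.Theorems.SahiCTCForms

open Finset

/-! ### The Kleitman layer weight `ω_m(s) = 1/(m·C(m−1,s))` (`s < m`; `0` otherwise) — kept as an explicit expression, no new definition -/

/-- The key identity behind the pivotal form, for the weight `ω_m(s) = 1/(m·C(m−1,s))` (`= s!(m−1−s)!/m!`), `m = r + s`: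
`r·ω_m(s) − s·ω_m(s−1) = [s = 0] − [r = 0]`. [this work] -/
theorem kleitWeight_identity (r s : ℕ) :
    (r : ℚ) * (if s < r + s then (((r + s : ℕ) : ℚ) * (((r + s - 1).choose s : ℕ) : ℚ))⁻¹ else 0)
      - (s : ℚ) * (if s - 1 < r + s then (((r + s : ℕ) : ℚ) * (((r + s - 1).choose (s - 1) : ℕ) : ℚ))⁻¹ else 0)
      = (if s = 0 then 1 else 0) - (if r = 0 then 1 else 0) := by
  rcases Nat.eq_zero_or_pos r with hr | hr <;> rcases Nat.eq_zero_or_pos s with hs | hs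
  · subst hr; subst hs; simp
  · -- r = 0, s ≥ 1 : the complementary pair
    subst hr
    obtain ⟨s', rfl⟩ : ∃ s', s = s' + 1 := ⟨s - 1, by omega⟩
    rw [if_neg (by omega), if_pos (by omega), if_neg (by omega), if_pos rfl]
    simp only [zero_add, show s' + 1 - 1 = s' by omega, Nat.choose_self, Nat.cast_one, mul_one, mul_zero, zero_sub]
    push_cast
    field_simp
  · -- r ≥ 1, s = 0 : the diagonal
    subst hs
    rw [if_pos (by omega), if_pos rfl, if_neg (by omega)]
    simp only [add_zero, Nat.choose_zero_right, Nat.cast_one, mul_one, Nat.cast_zero, zero_mul, sub_zero]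
    have : (r : ℚ) ≠ 0 := by exact_mod_cast hr.ne'
    field_simp
  · -- r, s ≥ 1 : Pascal-type cancellation `s·C(m−1,s) = r·C(m−1,s−1)`
    obtain ⟨s', rfl⟩ : ∃ s', s = s' + 1 := ⟨s - 1, by omega⟩
    rw [if_pos (by omega), if_pos (by omega), if_neg (by omega), if_neg (by omega), sub_zero, show s' + 1 - 1 = s' by omega]
    have hm : r + (s' + 1) - 1 = r + s' := by omega
    rw [hm]
    -- `C(r+s', s'+1)·(s'+1) = C(r+s', s')·r`
    have hpascal : ((r + s').choose (s' + 1) : ℚ) * (s' + 1) = ((r + s').choose s' : ℚ) * r := by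
      have h := Nat.choose_succ_right_eq (r + s') s'
      rw [show r + s' - s' = r by omega] at h
      exact_mod_cast h
    have h1 : ((r + s').choose s' : ℚ) ≠ 0 := by
      have : 0 < (r + s').choose s' := Nat.choose_pos (by omega)
      positivity
    have h2 : ((r + s').choose (s' + 1) : ℚ) ≠ 0 := by
      have : 0 < (r + s').choose (s' + 1) := Nat.choose_pos (by omega)
      positivity
    have h3 : ((r + (s' + 1) : ℕ) : ℚ) ≠ 0 := by positivity
    push_cast at h3 ⊢
    have key : (r : ℚ) * (((r + s').choose (s' + 1) : ℕ) : ℚ)⁻¹ = ((s' : ℚ) + 1) * (((r + s').choose s' : ℕ) : ℚ)⁻¹ := by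
      rw [mul_inv_eq_iff_eq_mul₀ h2]
      field_simp
      linear_combination -hpascal
    rw [mul_inv, mul_inv, ← mul_assoc, ← mul_assoc, mul_comm (r : ℚ), mul_comm ((s' : ℚ) + 1), mul_assoc, mul_assoc, key, sub_self]

/-! ### The pivotal Kleitman certificate: one `J`-table `w(b+c)`, the four other tables zero -/

/-- **The type identity**: if `w : ℕ → ℚ` satisfies `r·w(s) − s·w(s−1) = [s = 0] − [r = 0]` whenever `r + s = m`, then with the `J`-table
`(a,b,c) ↦ w(b+c)` and the other four tables zero, the coefficient of `[S ∈ 𝒳][S' ∈ 𝒵]` is `[S = S'] − [S ⊔ S' = W]`, i.e.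
`sepE(a,b,c,o) = [b = c = 0] − [a = o = 0]` whenever `a + b + c + o = m`. [this work] -/
theorem sepE_pivotal (m : ℕ) (w : ℕ → ℚ)
    (hw : ∀ r s : ℕ, r + s = m → (r : ℚ) * w s - (s : ℚ) * w (s - 1) = (if s = 0 then 1 else 0) - (if r = 0 then 1 else 0))
    (a b c o : ℕ) (h : a + b + c + o = m) :
    sepE (fun _ b c => w (b + c)) (fun _ _ _ => 0) (fun _ _ _ => 0) (fun _ _ _ => 0) (fun _ _ _ => 0) a b c o =
      (if b = 0 ∧ c = 0 then 1 else 0) - (if a = 0 ∧ o = 0 then 1 else 0) := by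
  have key := hw (a + o) (b + c) (by omega)
  have hC2 : (b : ℚ) * w (b - 1 + c) = (b : ℚ) * w (b + c - 1) := by
    rcases Nat.eq_zero_or_pos b with hb | hb
    · subst hb; simp
    · congr 2; omega
  have hC3 : (c : ℚ) * w (b + (c - 1)) = (c : ℚ) * w (b + c - 1) := by
    rcases Nat.eq_zero_or_pos c with hc | hc
    · subst hc; simp
    · congr 2; omega
  have hE : sepE (fun _ b c => w (b + c)) (fun _ _ _ => 0) (fun _ _ _ => 0) (fun _ _ _ => 0) (fun _ _ _ => 0) a b c o =
      ((a : ℚ) + o) * w (b + c) - ((b : ℚ) + c) * w (b + c - 1) := by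
    unfold sepE
    simp only [mul_zero, add_zero]
    rw [add_mul ((b : ℚ)), ← hC2, ← hC3]
    ring
  rw [hE]
  have hbc : (b = 0 ∧ c = 0) ↔ b + c = 0 := by omega
  have hao : (a = 0 ∧ o = 0) ↔ a + o = 0 := by omega
  simp only [hbc, hao]
  push_cast at key ⊢
  linarith [key]

/-! ### The surplus as a bilinear form and as the atom sum -/

variable {α : Type*} [DecidableEq α]

/-- The Kleitman surplus of the cube `2^W` as a bilinear form in the two indicator vectors:
`κ(∅,W) = Σ_{S,S' ⊆ W} [S ∈ 𝒳][S' ∈ 𝒵]·([S = S'] − [S ⊔ S' = W])`. [this work] -/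
theorem kap_empty_eq_sum (F G : Finset (Finset α)) (W : Finset α) :
    (kap F G ∅ W : ℚ) = ∑ S ∈ W.powerset, ∑ S' ∈ W.powerset,
      ιq F S * ιq G S' * ((if S = S' then (1 : ℚ) else 0) - (if Disjoint S S' ∧ S ∪ S' = W then 1 else 0)) := by
  -- split the double sum
  have hsplit : ∑ S ∈ W.powerset, ∑ S' ∈ W.powerset,
      ιq F S * ιq G S' * ((if S = S' then (1 : ℚ) else 0) - (if Disjoint S S' ∧ S ∪ S' = W then 1 else 0))
      = (∑ S ∈ W.powerset, ∑ S' ∈ W.powerset, ιq F S * ιq G S' * (if S = S' then (1 : ℚ) else 0))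
        - ∑ S ∈ W.powerset, ∑ S' ∈ W.powerset, ιq F S * ιq G S' * (if Disjoint S S' ∧ S ∪ S' = W then (1 : ℚ) else 0) := by
    rw [← sum_sub_distrib]; refine sum_congr rfl fun S _ => ?_
    rw [← sum_sub_distrib]; refine sum_congr rfl fun S' _ => ?_
    ring
  rw [hsplit]
  -- diagonal part
  have hdiag : ∑ S ∈ W.powerset, ∑ S' ∈ W.powerset, ιq F S * ιq G S' * (if S = S' then (1 : ℚ) else 0)
      = ((#(tr F ∅ W ∩ tr G ∅ W) : ℕ) : ℚ) := by
    have : ∀ S ∈ W.powerset, ∑ S' ∈ W.powerset, ιq F S * ιq G S' * (if S = S' then (1 : ℚ) else 0) = ιq F S * ιq G S := by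
      intro S hS
      rw [sum_eq_single S]
      · simp
      · intro S' _ hne; rw [if_neg (Ne.symm hne)]; ring
      · intro h; exact absurd hS h
    rw [sum_congr rfl this]
    rw [show ((#(tr F ∅ W ∩ tr G ∅ W) : ℕ) : ℚ) = ∑ S ∈ tr F ∅ W ∩ tr G ∅ W, (1 : ℚ) by simp]
    rw [show tr F ∅ W ∩ tr G ∅ W = W.powerset.filter (fun S => S ∈ F ∧ S ∈ G) by
      ext S; simp only [mem_inter, mem_tr_empty, mem_filter, mem_powerset]; tauto]
    rw [sum_filter]
    refine sum_congr rfl fun S _ => ?_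
    unfold ιq; by_cases h1 : S ∈ F <;> by_cases h2 : S ∈ G <;> simp [h1, h2]
  -- anti-diagonal part
  have hanti : ∑ S ∈ W.powerset, ∑ S' ∈ W.powerset, ιq F S * ιq G S' * (if Disjoint S S' ∧ S ∪ S' = W then (1 : ℚ) else 0)
      = ((#((tr F ∅ W).filter fun U => W \ U ∈ tr G ∅ W) : ℕ) : ℚ) := by
    have : ∀ S ∈ W.powerset, ∑ S' ∈ W.powerset, ιq F S * ιq G S' * (if Disjoint S S' ∧ S ∪ S' = W then (1 : ℚ) else 0)
        = ιq F S * ιq G (W \ S) := by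
      intro S hS
      have hSW : S ⊆ W := mem_powerset.1 hS
      rw [sum_eq_single (W \ S)]
      · rw [if_pos ⟨disjoint_sdiff, union_sdiff_of_subset hSW⟩]; ring
      · intro S' hS' hne
        rw [if_neg]; · ring
        rintro ⟨hd, hu⟩
        apply hne
        rw [← hu, union_sdiff_left, sdiff_eq_self_of_disjoint hd.symm]
      · intro h; exact absurd (mem_powerset.2 sdiff_subset) h
    rw [sum_congr rfl this]
    rw [show ((#((tr F ∅ W).filter fun U => W \ U ∈ tr G ∅ W) : ℕ) : ℚ) = ∑ S ∈ (tr F ∅ W).filter fun U => W \ U ∈ tr G ∅ W, (1 : ℚ) by simp]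
    rw [show ((tr F ∅ W).filter fun U => W \ U ∈ tr G ∅ W) = W.powerset.filter (fun S => S ∈ F ∧ W \ S ∈ G) by
      ext S; simp only [mem_filter, mem_tr_empty, mem_powerset, sdiff_subset, true_and]; tauto]
    rw [sum_filter]
    refine sum_congr rfl fun S _ => ?_
    unfold ιq; by_cases h1 : S ∈ F <;> by_cases h2 : W \ S ∈ G <;> simp [h1, h2]
  rw [hdiag, hanti]
  unfold kap
  push_cast
  ring

/-- **PIVOTAL FORM, general weight**: for any two families, any finset `W` and any `w : ℕ → ℚ` with
`r·w(s) − s·w(s−1) = [s = 0] − [r = 0]` for `r + s = #W`: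
`κ(∅,W) = Σ_{A,B ⊆ W, u ∈ W∖(A∪B)} w(#((A+u) ∆ (B+u)))·([A+u ∈ 𝒳] − [A ∈ 𝒳])·([B+u ∈ 𝒵] − [B ∈ 𝒵])`
(the atom sum of `…SahiCTCRtThreeSepDefs` with the `J`-table `(a,b,c) ↦ w(b+c)` and the other four tables zero). [this work] -/
theorem kap_empty_eq_atomSum_of (F G : Finset (Finset α)) (W : Finset α) (w : ℕ → ℚ)
    (hw : ∀ r s : ℕ, r + s = #W → (r : ℚ) * w s - (s : ℚ) * w (s - 1) = (if s = 0 then 1 else 0) - (if r = 0 then 1 else 0)) :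
    (kap F G ∅ W : ℚ) = atomSum (fun _ b c => w (b + c)) (fun _ _ _ => 0) (fun _ _ _ => 0) (fun _ _ _ => 0) (fun _ _ _ => 0) F G W := by
  rw [atomSum_eq_sum_sepE, kap_empty_eq_sum]
  refine sum_congr rfl fun S hS => sum_congr rfl fun S' hS' => ?_
  have hSW : S ⊆ W := mem_powerset.1 hS
  have hS'W : S' ⊆ W := mem_powerset.1 hS'
  have hsum : #(S ∩ S') + #(S \ S') + #(S' \ S) + #(W \ (S ∪ S')) = #W := by
    have h1 : #(S ∪ S') + #(S ∩ S') = #S + #S' := card_union_add_card_inter S S'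
    have h2 : #(W \ (S ∪ S')) = #W - #(S ∪ S') := card_sdiff_of_subset (union_subset hSW hS'W)
    have h3 : #(S ∪ S') ≤ #W := card_le_card (union_subset hSW hS'W)
    have h4 : #(S ∩ S') + #(S \ S') = #S := card_inter_add_card_sdiff S S'
    have h5 : #(S ∩ S') + #(S' \ S) = #S' := by rw [inter_comm]; exact card_inter_add_card_sdiff S' S
    omega
  rw [sepE_pivotal _ w hw _ _ _ _ hsum]
  congr 2
  · -- [b = c = 0] ↔ S = S'
    have : (#(S \ S') = 0 ∧ #(S' \ S) = 0) ↔ S = S' := by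
      rw [card_eq_zero, card_eq_zero, sdiff_eq_empty_iff_subset, sdiff_eq_empty_iff_subset]
      exact ⟨fun h => Subset.antisymm h.1 h.2, fun h => ⟨h.le, h.ge⟩⟩
    simp only [this]
  · -- [a = o = 0] ↔ S ⊔ S' = W
    have : (#(S ∩ S') = 0 ∧ #(W \ (S ∪ S')) = 0) ↔ (Disjoint S S' ∧ S ∪ S' = W) := by
      rw [card_eq_zero, card_eq_zero, sdiff_eq_empty_iff_subset, ← disjoint_iff_inter_eq_empty]
      exact ⟨fun h => ⟨h.1, Subset.antisymm (union_subset hSW hS'W) h.2⟩, fun h => ⟨h.1, h.2.ge⟩⟩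
    simp only [this]

/-- **PIVOTAL FORM OF KLEITMAN'S LEMMA** with the explicit Kleitman layer weights `ω_m(s) = 1/(m·C(m−1,s))` (`s < m`), `m = #W`:
`κ(∅,W) = Σ_{A,B ⊆ W, u ∈ W∖(A∪B)} ω_m(#((A+u) ∆ (B+u)))·([A+u ∈ 𝒳] − [A ∈ 𝒳])·([B+u ∈ 𝒵] − [B ∈ 𝒵])` for ANY two families. [this work] -/
theorem kap_empty_eq_atomSum (F G : Finset (Finset α)) (W : Finset α) :
    (kap F G ∅ W : ℚ) = atomSum (fun _ b c => if b + c < #W then (((#W : ℕ) : ℚ) * (((#W - 1).choose (b + c) : ℕ) : ℚ))⁻¹ else 0)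
      (fun _ _ _ => 0) (fun _ _ _ => 0) (fun _ _ _ => 0) (fun _ _ _ => 0) F G W := by
  refine kap_empty_eq_atomSum_of F G W (fun s => if s < #W then (((#W : ℕ) : ℚ) * (((#W - 1).choose s : ℕ) : ℚ))⁻¹ else 0) ?_
  intro r s hrs
  have := kleitWeight_identity r s
  rw [hrs] at this
  exact this

/-- Kleitman's lemma re-proved from the pivotal form: for up-sets every atom is `≥ 0` (`atomSum_nonneg`). [this work] -/
theorem kap_empty_nonneg' {F G : Finset (Finset α)} (hF : IsUpperSet (F : Set (Finset α))) (hG : IsUpperSet (G : Set (Finset α)))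
    (W : Finset α) : 0 ≤ kap F G ∅ W := by
  have h := atomSum_nonneg (fun _ b c => if b + c < #W then (((#W : ℕ) : ℚ) * (((#W - 1).choose (b + c) : ℕ) : ℚ))⁻¹ else 0)
    (fun _ _ _ => 0) (fun _ _ _ => 0) (fun _ _ _ => 0) (fun _ _ _ => 0) hF hG
    (fun _ b c => by split_ifs <;> positivity) (fun _ _ _ => le_rfl) (fun _ _ _ => le_rfl) (fun _ _ _ => le_rfl)
    (fun _ _ _ => le_rfl) W
  rw [← kap_empty_eq_atomSum] at h
  exact_mod_cast h

end Summit.CriticalPhenomena.PercolationContinuityZ3.Theorems.SahiCTCForms
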